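import Summits.QuantumAdvantage.QuantumAdvantage.Theorems.CubicForrelationNearExactIsExactTwelveLevelFive932
import Summits.QuantumAdvantage.QuantumAdvantage.Theorems.CubicForrelationNearExactIsExactTwelveTypeO941
import Summits.QuantumAdvantage.QuantumAdvantage.Theorems.CubicForrelationNearExactIsExactTwelveLevelSixLt

/-!
# Crux `CubicForrelation.NearExactIsExact` (stmt-QuantumAdvantage-14043) — n = 12, level ≥ 6 (both sides): the configuration "`e ≡ ±1 (mod 8)` on the
  9-flat with `e² ∈ {1, 49}`, on-flat excess `≤ D`, off-flat energy `≤ E`, `3E + 4D < 1440`" is killed TWO-SIDEDLY (the version of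
  `tw16_levelSix_sparse_false` that tolerates points with `|e| = 7` on the flat)

Certificate seat `b2b-cforr-cert` (gen 16).  HONEST FRAMING: a kernel-checked lemma (standard axioms) about cubic Boolean pairs on 12 bits — the
sparse sub-branch of the `n = 12` window analysis at `937/1024, 938/1024`, where the budget affords one point of the 9-flat with `|e| = 7`; finite-slice
statement, NOT summit progress.  Same proof as `tw16_levelSix_sparse_false` with the sign pattern `σ ≡ e (mod 8)` (`σ = ±1`) in place of `e|_Z`:
(H3)/(H4) pass from `e` to `σ` because `8 ∣ e − σ` pointwise; `A = σ·1_Z` has `≤ 32` non-zero transform values; the remainder `G = (e − σ)·1_Z + e·1_{∁Z}`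
has `Σ G² = Σ_Z (e − σ)² + Σ_{∉Z} e² ≤ (4/3)D + E` (pointwise `(e − σ)² = 64 = (4/3)·48` at the points with `e² = 49`), so `|Ĝ| ≥ 64` at `≤ E + 4D/3`
points, and the count of the partner's odd residual gives `512 ≤ 32 + E + 4D/3 < 512`.

References: J. Ax (1964) / R. J. McEliece (1972); MacWilliams–Sloane (1977) Ch. 13–15; R. O'Donnell (2014) §3.3; C. Carlet (2021) §5.2.
Everything below is proved from Mathlib and the tree; axioms are the standard three.
-/



set_option linter.dupNamespace false -- D-0017: single-problem summit ⇒ `QuantumAdvantage.QuantumAdvantage` by design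

noncomputable section

namespace Summit.QuantumAdvantage.QuantumAdvantage.Theorems.CubicForrelation.NearExactIsExact

open Finset
open Literature.Computability.QuantumComplexity
open Literature.Computability.QuantumComplexity.BuzetChailloux (bxor zeroVec bxor_bxor_cancel_left bxor_zeroVec zeroVec_bxor bxor_comm
  bxor_self signOf_sq)
open Literature.Computability.QuantumComplexity.DerivativeWalsh (W sum_W_sq)

/-! ### The two-sided kill with points of `|e| = 7` on the flat -/

/-- **The level-`≥ 6` configuration with `e² ∈ {1, 49}` on the flat is impossible (two-sided kill)** when the off-flat energy `E` and the
on-flat excess `D` satisfy `3E + 4D < 1440`.  See the module docstring. [this work] -/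
theorem tw16_levelSix_sparse7_false (E D : ℤ) (hE : 3 * E + 4 * D < 1440) (f g : (Fin (6 + 6) → Bool) → Bool) (hf : IsDegLeFun 3 f) (hg : IsDegLeFun 3 g)
    (u'' : (Fin (6 + 6) → Bool) → ℤ) (hu'' : ∀ x, W (fun y => signOf (g y)) x = (2 : ℝ) ^ 6 * (u'' x : ℝ))
    (wf : (Fin (6 + 6) → Bool) → ℤ) (hwf : ∀ y, W (fun x => signOf (f x)) y = (2 : ℝ) ^ 6 * (wf y : ℝ))
    (hlo : (7 / 8 : ℝ) < forrelation f g) (hhi : forrelation f g < 1)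
    (V₀ : Finset (Fin (6 + 6) → Bool)) (xZ : Fin (6 + 6) → Bool) (h0 : zeroVec ∈ V₀)
    (hadd : ∀ a ∈ V₀, ∀ b ∈ V₀, bxor a b ∈ V₀) (hcardV : #V₀ = 512)
    (hS : (univ.filter fun x : Fin (6 + 6) → Bool => ¬ Odd (u'' x)) = V₀.image (bxor xZ))
    (hZ1 : ∀ x ∈ (univ.filter fun x : Fin (6 + 6) → Bool => ¬ Odd (u'' x)), (u'' x - sZ (f x)) ^ 2 = 1 ∨ (u'' x - sZ (f x)) ^ 2 = 49)
    (hDZ : ∑ x ∈ (univ.filter fun x : Fin (6 + 6) → Bool => ¬ Odd (u'' x)), ((u'' x - sZ (f x)) ^ 2 - 1) ≤ D)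
    (hoffE : ∑ x ∈ univ.filter (fun x => x ∉ (univ.filter fun x : Fin (6 + 6) → Bool => ¬ Odd (u'' x))),
      (u'' x - sZ (f x)) ^ 2 ≤ E)
    (H3 : ∀ x ∈ (univ.filter fun x : Fin (6 + 6) → Bool => ¬ Odd (u'' x)), ∀ a b c : Fin (6 + 6) → Bool,
      a ∈ V₀ → b ∈ V₀ → c ∈ V₀ →
      (4 : ℤ) ∣ ∑ ε : Fin 3 → Bool, (u'' (fun j => x j ^^ decide (Odd #(univ.filter fun i =>
        ε i && (![a, b, c] : Fin 3 → Fin (6 + 6) → Bool) i j))) - sZ (f (fun j => x j ^^ decide (Odd #(univ.filter fun i =>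
        ε i && (![a, b, c] : Fin 3 → Fin (6 + 6) → Bool) i j))))))
    (H4 : ∀ x ∈ (univ.filter fun x : Fin (6 + 6) → Bool => ¬ Odd (u'' x)), ∀ a₀ a₁ a₂ a₃ : Fin (6 + 6) → Bool,
      a₀ ∈ V₀ → a₁ ∈ V₀ → a₂ ∈ V₀ → a₃ ∈ V₀ →
      (8 : ℤ) ∣ ∑ ε : Fin 4 → Bool, (u'' (fun j => x j ^^ decide (Odd #(univ.filter fun i =>
        ε i && (![a₀, a₁, a₂, a₃] : Fin 4 → Fin (6 + 6) → Bool) i j))) - sZ (f (fun j => x j ^^ decide (Odd #(univ.filter fun i =>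
        ε i && (![a₀, a₁, a₂, a₃] : Fin 4 → Fin (6 + 6) → Bool) i j)))))) : False := by
  classical
  set Z := univ.filter (fun x : Fin (6 + 6) → Bool => ¬ Odd (u'' x)) with hZdef
  set e : (Fin (6 + 6) → Bool) → ℤ := fun x => u'' x - sZ (f x) with hedef
  change ∀ x ∈ Z, e x ^ 2 = 1 ∨ e x ^ 2 = 49 at hZ1
  change ∑ x ∈ Z, (e x ^ 2 - 1) ≤ D at hDZ
  change ∑ x ∈ univ.filter (fun x => x ∉ Z), e x ^ 2 ≤ E at hoffE
  change ∀ x ∈ Z, ∀ a b c : Fin (6 + 6) → Bool, a ∈ V₀ → b ∈ V₀ → c ∈ V₀ →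
      (4 : ℤ) ∣ ∑ ε : Fin 3 → Bool, e (fun j => x j ^^ decide (Odd #(univ.filter fun i =>
        ε i && (![a, b, c] : Fin 3 → Fin (6 + 6) → Bool) i j))) at H3
  change ∀ x ∈ Z, ∀ a₀ a₁ a₂ a₃ : Fin (6 + 6) → Bool, a₀ ∈ V₀ → a₁ ∈ V₀ → a₂ ∈ V₀ → a₃ ∈ V₀ →
      (8 : ℤ) ∣ ∑ ε : Fin 4 → Bool, e (fun j => x j ^^ decide (Odd #(univ.filter fun i =>
        ε i && (![a₀, a₁, a₂, a₃] : Fin 4 → Fin (6 + 6) → Bool) i j))) at H4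
  have hxZ : xZ ∈ Z := by rw [hS]; exact mem_image.2 ⟨zeroVec, h0, bxor_zeroVec xZ⟩
  have hPV : ∀ x, x ∈ Z → ∀ a ∈ V₀, bxor x a ∈ Z := fun x hx a ha => fl1_coset_vadd hadd hS hx ha
  have hVP : ∀ x, x ∈ Z → bxor xZ x ∈ V₀ := fun x hx => fl1_coset_diff hS hx
  /- (1) the sign pattern `σ ≡ e (mod 8)`: `e = σ + 8μ` on `Z` with `(8μ)² ≤ (4/3)(e² − 1)`; `A = σ·1_Z` has `≤ 32` non-zero transform values -/
  have he17 : ∀ x ∈ Z, e x = 1 ∨ e x = -1 ∨ e x = 7 ∨ e x = -7 := by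
    intro x hx
    rcases hZ1 x hx with h | h
    · have h1 : e x = 1 ∨ e x = -1 := mul_self_eq_one_iff.1 (by rw [← sq]; exact h)
      rcases h1 with h1 | h1
      · exact Or.inl h1
      · exact Or.inr (Or.inl h1)
    · have h7 : (e x - 7) * (e x + 7) = 0 := by nlinarith
      rcases mul_eq_zero.1 h7 with h1 | h1
      · right; right; left; linarith
      · right; right; right; linarith
  set h : (Fin (6 + 6) → Bool) → Bool := fun x => decide (e x = -1 ∨ e x = 7) with hh
  have heh : ∀ x ∈ Z, ∃ μ : ℤ, e x = sZ (h x) + 8 * μ ∧ 3 * (8 * μ) ^ 2 ≤ 4 * (e x ^ 2 - 1) := by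
    intro x hx
    rcases he17 x hx with h1 | h1 | h1 | h1
    · refine ⟨0, ?_, ?_⟩ <;> simp [hh, h1, sZ]
    · refine ⟨0, ?_, ?_⟩ <;> simp [hh, h1, sZ]
    · refine ⟨1, ?_, ?_⟩ <;> simp [hh, h1, sZ]
    · refine ⟨-1, ?_, ?_⟩ <;> simp [hh, h1, sZ]
  have hflat_transfer : ∀ (m : ℕ) (c : ℤ) (hc : c ∣ 8) (pts : (Fin m → Bool) → (Fin (6 + 6) → Bool)), (∀ ε, pts ε ∈ Z) →
      c ∣ ∑ ε, e (pts ε) → c ∣ ∑ ε, sZ (h (pts ε)) := by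
    intro m c hc pts hpts hsum
    choose μ hμ using fun ε => heh (pts ε) (hpts ε)
    have hs : ∑ ε, e (pts ε) = ∑ ε, sZ (h (pts ε)) + 8 * ∑ ε, μ ε := by
      rw [mul_sum, ← sum_add_distrib]; exact sum_congr rfl fun ε _ => (hμ ε).1
    rw [hs] at hsum
    have h8 : c ∣ 8 * ∑ ε, μ ε := dvd_mul_of_dvd_left hc _
    exact (dvd_add_left h8).1 hsum
  have H3' : ∀ x, x ∈ Z → ∀ a b c : Fin (6 + 6) → Bool, a ∈ V₀ → b ∈ V₀ → c ∈ V₀ →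
      (4 : ℤ) ∣ ∑ ε : Fin 3 → Bool, sZ (h (fun j => x j ^^ decide (Odd #(univ.filter fun i =>
        ε i && (![a, b, c] : Fin 3 → Fin (6 + 6) → Bool) i j)))) := by
    intro x hx a b c ha hb hc
    exact hflat_transfer 3 4 (by norm_num) _ (fun ε => fr_mem_flatPt3 V₀ h0 (· ∈ Z) hPV hx ![a, b, c]
      (fun i => by fin_cases i <;> assumption) ε) (H3 x hx a b c ha hb hc)
  have H4' : ∀ x, x ∈ Z → ∀ a₀ a₁ a₂ a₃ : Fin (6 + 6) → Bool, a₀ ∈ V₀ → a₁ ∈ V₀ → a₂ ∈ V₀ → a₃ ∈ V₀ →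
      (8 : ℤ) ∣ ∑ ε : Fin 4 → Bool, sZ (h (fun j => x j ^^ decide (Odd #(univ.filter fun i =>
        ε i && (![a₀, a₁, a₂, a₃] : Fin 4 → Fin (6 + 6) → Bool) i j)))) := by
    intro x hx a₀ a₁ a₂ a₃ ha₀ ha₁ ha₂ ha₃
    exact hflat_transfer 4 8 (dvd_refl _) _ (fun ε => fr_mem_flatPt4 V₀ h0 (· ∈ Z) hPV hx ![a₀, a₁, a₂, a₃]
      (fun i => by fin_cases i <;> assumption) ε) (H4 x hx a₀ a₁ a₂ a₃ ha₀ ha₁ ha₂ ha₃)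
  set R := V₀.filter (fun a => ∀ b ∈ V₀, (h xZ ^^ h (bxor xZ a) ^^ h (bxor xZ b) ^^ h (bxor (bxor xZ a) b)) = false) with hR
  have hsd := fr_hsd V₀ (· ∈ Z) xZ hxZ hVP h H3'
  have hlarge : #V₀ ≤ 4 * #R := fr_radical_large V₀ (· ∈ Z) xZ h hadd hxZ hPV hVP H3' H4'
  have hR0 : zeroVec ∈ R := fr_radical_zero_mem V₀ xZ h h0
  have hRadd : ∀ a ∈ R, ∀ b ∈ R, bxor a b ∈ R := fr_radical_add V₀ (· ∈ Z) xZ h hxZ hPV hadd hsd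
  set A : (Fin (6 + 6) → Bool) → ℝ := fun x => if x ∈ Z then ((sZ (h x) : ℤ) : ℝ) else 0 with hA
  have hper : ∀ a ∈ R, ∃ c : ℝ, (c = 1 ∨ c = -1) ∧ ∀ x, A (bxor x a) = c * A x := by
    intro a ha
    have haV : a ∈ V₀ := (mem_filter.1 ha).1
    refine ⟨((sZ (h xZ ^^ h (bxor xZ a)) : ℤ) : ℝ), ?_, fun x => ?_⟩
    · rcases tp_sZ_cases (h xZ ^^ h (bxor xZ a)) with hc | hc <;> rw [hc] <;> norm_num
    · by_cases hx : x ∈ Z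
      · have hxa : bxor x a ∈ Z := hPV x hx a haV
        simp only [A, if_pos hx, if_pos hxa]
        rw [fr_radical_period V₀ (· ∈ Z) xZ h hxZ hVP hsd ha hx]
        rw [tp_sZ_cast, tp_sZ_cast, tp_sZ_cast, signOf_xor]
        ring
      · have hxa : bxor x a ∉ Z := fl1_coset_out' hadd hS hx haV
        simp only [A, if_neg hx, if_neg hxa, mul_zero]
  have hsupp := fp_card_supp_mul_le A R hR0 hRadd hper
  have hsuppA : #(univ.filter fun y : Fin (6 + 6) → Bool => W A y ≠ 0) ≤ 32 := by
    rw [hcardV] at hlarge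
    have hR : 128 ≤ #R := by omega
    have h1 : #(univ.filter fun y : Fin (6 + 6) → Bool => W A y ≠ 0) * 128 ≤ 2 ^ (6 + 6) :=
      le_trans (Nat.mul_le_mul_left _ hR) hsupp
    rw [show 2 ^ (6 + 6) = 4096 by norm_num] at h1
    omega
  /- (2) the partner's level-6 representation `W_f = 64 w_f` is a hypothesis; symmetry of `Φ` -/
  have hΦ' : forrelation g f = forrelation f g := by
    rw [Summit.QuantumAdvantage.QuantumAdvantage.Theorems.SignedCubicForrelationNotPrBPP.Negative.HalfQuad.forrelation_comm]
  /- (3) residual duality: `ê(y) = 64 (−1)^{g(y)} − 64 w_f(y)` -/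
  set eR : (Fin (6 + 6) → Bool) → ℝ := fun x => (e x : ℝ) with heR
  have hdual : ∀ y, W eR y = 64 * signOf (g y) - 64 * (wf y : ℝ) := by
    intro y
    have hinv := tz_inversion (fun y => signOf (g y)) y
    have hWg : ∀ x, W (fun y => signOf (g y)) x = 64 * (signOf (f x) + eR x) := by
      intro x; rw [hu'' x]; simp only [eR, e]; push_cast; rw [tp_sZ_cast]; ring
    rw [sum_congr rfl fun x _ => by rw [hWg x]] at hinv
    have hsum : ∑ x, 64 * (signOf (f x) + eR x) * twist x y = 64 * W (fun x => signOf (f x)) y + 64 * W eR y := by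
      unfold W; rw [mul_sum, mul_sum, ← sum_add_distrib]; exact sum_congr rfl fun x _ => by ring
    rw [hsum, hwf y, show (2 : ℝ) ^ (6 + 6) = 4096 by norm_num, show (2 : ℝ) ^ 6 = 64 by norm_num] at hinv
    linarith
  /- (4) the partner's residual is odd on `≥ 512` points -/
  have hZf : 512 ≤ #(univ.filter fun y : Fin (6 + 6) → Bool => ¬ Odd (wf y)) := by
    have hp : IsDegLeFun 3 (fun x => decide (Odd (wf x))) :=
      stub_walshTower stub_axParity (6 + 6) 6 3 f wf hf hwf (by intro k hk hkn; omega)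
    by_cases hall : ∀ y, Odd (wf y)
    · exfalso
      -- `f` would be bent, and then `Φ ∈ {1} ∪ [0, 7/8]`
      have hpar : ∑ x, wf x ^ 2 = 4096 := by
        have h := zms_sum_u_sq 2 f (fun x => 4 * wf x) (fun x => by rw [hwf x]; push_cast; ring)
        have e4 : ∑ x, (((4 * wf x : ℤ)) : ℝ) ^ 2 = 16 * ∑ x, ((wf x : ℝ)) ^ 2 := by
          rw [mul_sum]; exact sum_congr rfl fun x _ => by push_cast; ring
        rw [e4] at h
        norm_num at h
        have h' : ∑ x, ((wf x : ℝ)) ^ 2 = 4096 := by linarith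
        exact_mod_cast h'
      have hge : ∀ x, (1 : ℤ) ≤ wf x ^ 2 := fun x => by
        have h0' := Int.odd_iff.1 (hall x)
        have : wf x ≤ -1 ∨ 1 ≤ wf x := by omega
        have := tp_sq_ge (k := 1) (by norm_num) this
        linarith
      have hsq1' : ∀ x, wf x ^ 2 = 1 := by
        have hsum0 : ∑ x, (wf x ^ 2 - 1 : ℤ) = 0 := by
          rw [sum_sub_distrib, hpar, sum_const, card_univ, Fintype.card_fun, Fintype.card_bool, Fintype.card_fin]; norm_num
        intro x
        have := (sum_eq_zero_iff_of_nonneg fun y _ => by have := hge y; linarith).1 hsum0 x (mem_univ x)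
        linarith
      have hbent : ∀ x, W (fun y => signOf (f y)) x ^ 2 = (2 : ℝ) ^ (6 + 6) := by
        intro x
        rw [hwf x, mul_pow]
        have : ((wf x : ℝ)) ^ 2 = 1 := by exact_mod_cast hsq1' x
        rw [this]; norm_num
      rcases tw_bent_end (by norm_num) g f hg hf hbent with h1 | h1
      · rw [hΦ'] at h1; linarith
      · rw [hΦ'] at h1; linarith
    · push Not at hall
      obtain ⟨x₁, hx₁⟩ := hall
      have hp' : IsDegLeFun 3 (fun x => decide (Odd (wf x)) ^^ true) := tb_isDegLeFun_xor_const hp true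
      have hfilt : (univ.filter fun x : Fin (6 + 6) → Bool => (decide (Odd (wf x)) ^^ true) = true) =
          univ.filter fun y : Fin (6 + 6) → Bool => ¬ Odd (wf y) := filter_congr fun x _ => by simp
      have hRM := bb_rmWeight_holds (6 + 6) 3 (fun x => decide (Odd (wf x)) ^^ true) hp' ⟨x₁, by simpa using hx₁⟩
      rw [hfilt, show 2 ^ (6 + 6) = 4096 by norm_num, show 2 ^ 3 = 8 by norm_num] at hRM
      omega
  /- (5) `ê = Â + Ĝ` with `G = (e − σ)·1_Z + e·1_{∁Z}`, Parseval for `Ĝ`: `Σ G² ≤ (4/3)D + E` -/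
  set Eoff : (Fin (6 + 6) → Bool) → ℝ := fun x => if x ∈ Z then ((e x : ℝ) - ((sZ (h x) : ℤ) : ℝ)) else (e x : ℝ) with hEoff
  have hsplitW : ∀ y, W eR y = W A y + W Eoff y := by
    intro y
    unfold W
    rw [← sum_add_distrib]
    refine sum_congr rfl fun x _ => ?_
    simp only [A, Eoff, eR]
    split_ifs <;> ring
  have hParsE : 3 * ∑ y, W Eoff y ^ 2 ≤ 4096 * (3 * (E : ℝ) + 4 * (D : ℝ)) := by
    rw [sum_W_sq]
    have hsplitG : ∑ x, Eoff x ^ 2 = ∑ x ∈ Z, Eoff x ^ 2 + ∑ x ∈ univ.filter (fun x => x ∉ Z), Eoff x ^ 2 := by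
      rw [← sum_filter_add_sum_filter_not univ (fun x => x ∈ Z)]
      congr 1
      exact sum_congr (by ext x; simp) fun _ _ => rfl
    have hGoff : ∑ x ∈ univ.filter (fun x => x ∉ Z), Eoff x ^ 2 = ((∑ x ∈ univ.filter (fun x => x ∉ Z), e x ^ 2 : ℤ) : ℝ) := by
      push_cast
      refine sum_congr rfl fun x hx => ?_
      simp only [Eoff, if_neg (mem_filter.1 hx).2]
    have hGon : 3 * ∑ x ∈ Z, Eoff x ^ 2 ≤ 4 * ((∑ x ∈ Z, (e x ^ 2 - 1) : ℤ) : ℝ) := by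
      push_cast
      rw [mul_sum, mul_sum]
      refine sum_le_sum fun x hx => ?_
      obtain ⟨μ, hμ, hμb⟩ := heh x hx
      simp only [Eoff, if_pos hx]
      have e1 : (e x : ℝ) - ((sZ (h x) : ℤ) : ℝ) = 8 * (μ : ℝ) := by
        have : ((e x : ℤ) : ℝ) = (((sZ (h x) + 8 * μ : ℤ)) : ℝ) := by rw [← hμ]
        rw [this]; push_cast; ring
      rw [e1]
      have hb : ((3 * (8 * μ) ^ 2 : ℤ) : ℝ) ≤ ((4 * (e x ^ 2 - 1) : ℤ) : ℝ) := by exact_mod_cast hμb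
      push_cast at hb
      exact hb
    have hoffR : ((∑ x ∈ univ.filter (fun x => x ∉ Z), e x ^ 2 : ℤ) : ℝ) ≤ (E : ℝ) := by exact_mod_cast hoffE
    have hDR : ((∑ x ∈ Z, (e x ^ 2 - 1) : ℤ) : ℝ) ≤ (D : ℝ) := by exact_mod_cast hDZ
    rw [hsplitG, hGoff, show (2 : ℝ) ^ (6 + 6) = 4096 by norm_num]
    nlinarith
  have hbig : 3 * (#(univ.filter fun y : Fin (6 + 6) → Bool => (4096 : ℝ) ≤ W Eoff y ^ 2) : ℤ) ≤ 3 * E + 4 * D := by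
    have h1 : (#(univ.filter fun y : Fin (6 + 6) → Bool => (4096 : ℝ) ≤ W Eoff y ^ 2) : ℝ) * 4096 ≤ ∑ y, W Eoff y ^ 2 := by
      have h := sum_le_sum fun y (hy : y ∈ univ.filter fun y : Fin (6 + 6) → Bool => (4096 : ℝ) ≤ W Eoff y ^ 2) => (mem_filter.1 hy).2
      rw [sum_const, nsmul_eq_mul] at h
      exact h.trans (sum_le_sum_of_subset_of_nonneg (subset_univ _) fun y _ _ => sq_nonneg _)
    have h2 : 3 * (#(univ.filter fun y : Fin (6 + 6) → Bool => (4096 : ℝ) ≤ W Eoff y ^ 2) : ℝ) ≤ 3 * (E : ℝ) + 4 * (D : ℝ) := by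
      nlinarith
    exact_mod_cast h2
  /- (6) covering and counting: `512 ≤ 32 + (3E + 4D)/3 < 512` -/
  have hcover : (univ.filter fun y : Fin (6 + 6) → Bool => ¬ Odd (wf y)) ⊆
      (univ.filter fun y : Fin (6 + 6) → Bool => W A y ≠ 0) ∪ (univ.filter fun y : Fin (6 + 6) → Bool => (4096 : ℝ) ≤ W Eoff y ^ 2) := by
    intro y hy
    have hyev : Even (wf y) := Int.not_odd_iff_even.1 (mem_filter.1 hy).2
    -- `|w_f − (−1)^g| ≥ 1`, hence `ê(y)² ≥ 4096`
    have hsq : (4096 : ℝ) ≤ W eR y ^ 2 := by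
      obtain ⟨k, hk⟩ := hyev
      have hodd : wf y - sZ (g y) ≤ -1 ∨ 1 ≤ wf y - sZ (g y) := by
        rcases tp_sZ_cases (g y) with hs | hs <;> rw [hs] <;> omega
      have h1 := tp_sq_ge (k := 1) (by norm_num) hodd
      have h1R : (1 : ℝ) ≤ ((wf y : ℝ) - signOf (g y)) ^ 2 := by
        rw [← tp_sZ_cast]; exact_mod_cast h1
      rw [hdual y]
      nlinarith
    by_cases hAy : W A y ≠ 0
    · exact mem_union_left _ (mem_filter.2 ⟨mem_univ _, hAy⟩)
    · push Not at hAy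
      refine mem_union_right _ (mem_filter.2 ⟨mem_univ _, ?_⟩)
      have : W Eoff y = W eR y := by rw [hsplitW y, hAy, zero_add]
      rw [this]; exact hsq
  have hcard := (card_le_card hcover).trans (card_union_le _ _)
  omega

end Summit.QuantumAdvantage.QuantumAdvantage.Theorems.CubicForrelation.NearExactIsExact

end
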